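import Summits.RiemannHypothesis.RiemannHypothesis.Theorems.PfPersistenceF1PWOneFreq

/-!
# PF persistence, fake seat 1 — the logical skeleton of the AP-test (FAKES §1.14 (f), §1.15 F1-V.4/F1-V.5)

Unit `pub-rhpf-fake-1` of the `pub-rhpf` cell (mechanism / rigidity campaign; **no RH claims**).

The AP-test (COROLLARY F1-V.2) sorts twins of `μ_Z` by the large-height behaviour of a Poisson-smoothed
functional `R[ν](t)`: for an HONEST twin it is an almost periodic function of `t`, while for the ROUND
member (F1-V.4, F1-V.5; conditional on the adiabatic transfer) it is an almost periodic function PLUS a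
transient `c · cos(ω t)/log t + o(1/log t)` with `c ≠ 0`.  The conclusion 'the round member is dishonest'
rests on the purely logical fact typed and PROVED here, with Bohr's definition of almost periodicity
(relatively dense ε-almost periods; continuity is not needed):

* `eq_zero_of_isBohrAP_of_small` — a Bohr almost periodic function that is eventually `ε`-small for every
  `ε` vanishes identically;
* `not_isBohrAP_of_log_transient` — hence a function of the form `c cos(ω t)/log t + e(t)` with `c ≠ 0`,
  `ω > 0` and `e(t) log t → 0` is NOT Bohr almost periodic (evaluate at `t = 2πk/ω`).

So if `R_round − A` (with `A` the honest almost periodic candidate) has that form, `R_round − A` is not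
almost periodic, and `R_round` cannot coincide with any honest `R[μ_P]` whose difference from `A` is almost
periodic.  The analytic inputs (honest ⇒ a.p.; round ⇒ transient) are NOT asserted here.  Elementary real
analysis; nothing about `ζ` is asserted.
-/

set_option linter.dupNamespace false

namespace Summit.RiemannHypothesis.RiemannHypothesis.Theorems.PfPersistence.Fake1.APTest

/-- Bohr almost periodicity of `f : ℝ → ℝ` (without the continuity clause): every `ε > 0` admits a
length `ℓ` such that every interval `[a, a + ℓ]` contains an `ε`-almost period `τ`. [folklore; Bohr] -/
def IsBohrAP (f : ℝ → ℝ) : Prop :=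
  ∀ ε > 0, ∃ ℓ > 0, ∀ a : ℝ, ∃ τ ∈ Set.Icc a (a + ℓ), ∀ t : ℝ, |f (t + τ) - f t| ≤ ε

/-- Constant functions are Bohr almost periodic (sanity check of the definition). [folklore] -/
theorem isBohrAP_const (c : ℝ) : IsBohrAP fun _ => c := by
  intro ε hε
  refine ⟨1, one_pos, fun a => ⟨a, ⟨le_rfl, by linarith⟩, fun t => ?_⟩⟩
  simp [hε.le]

/-- A Bohr almost periodic function which is eventually `ε`-small for every `ε > 0` vanishes
identically: almost periods transport the smallness from `+∞` back to any `t`. [folklore; Bohr] -/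
theorem eq_zero_of_isBohrAP_of_small {f : ℝ → ℝ} (hap : IsBohrAP f)
    (h0 : ∀ ε > 0, ∃ T : ℝ, ∀ s ≥ T, |f s| ≤ ε) (t : ℝ) : f t = 0 := by
  by_contra hne
  have hpos : 0 < |f t| := abs_pos.2 hne
  obtain ⟨ℓ, -, hτ⟩ := hap (|f t| / 3) (by positivity)
  obtain ⟨T, hT⟩ := h0 (|f t| / 3) (by positivity)
  obtain ⟨τ, hτmem, hτap⟩ := hτ (T - t)
  have h1 : T ≤ t + τ := by have := hτmem.1; linarith
  have h2 : |f (t + τ)| ≤ |f t| / 3 := hT _ h1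
  have h3 : |f (t + τ) - f t| ≤ |f t| / 3 := hτap t
  have h4 := abs_sub_le (f t) (f (t + τ)) 0
  simp only [sub_zero] at h4
  rw [abs_sub_comm] at h4
  linarith

/-- **AP-test skeleton**: `g(t) = c cos(ω t)/log t + e(t)` with `c ≠ 0`, `ω > 0` and `e(t) log t → 0`
(stated in `ε`–`T` form) is NOT Bohr almost periodic.  Indeed `g` is eventually small, so Bohr almost
periodicity would force `g ≡ 0`, but at `t = 2πk/ω` (large `k`) this reads `e(t) log t = −c`. [folklore] -/
theorem not_isBohrAP_of_log_transient {g e : ℝ → ℝ} {c ω : ℝ} (hc : c ≠ 0) (hω : 0 < ω)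
    (hg : ∀ t, g t = c * Real.cos (ω * t) / Real.log t + e t)
    (he : ∀ ε > 0, ∃ T : ℝ, ∀ s ≥ T, |e s * Real.log s| ≤ ε) : ¬ IsBohrAP g := by
  intro hap
  have hcpos : 0 < |c| := abs_pos.2 hc
  -- Step 1: `g` is eventually `ε`-small for every `ε`.
  have h0 : ∀ ε > 0, ∃ T : ℝ, ∀ s ≥ T, |g s| ≤ ε := by
    intro ε hε
    obtain ⟨T₁, hT₁⟩ := he (ε / 2) (by positivity)
    refine ⟨max (max T₁ (Real.exp 1)) (Real.exp (2 * |c| / ε)), fun s hs => ?_⟩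
    have hs1 : T₁ ≤ s := le_trans (le_trans (le_max_left _ _) (le_max_left _ _)) hs
    have hse : Real.exp 1 ≤ s := le_trans (le_trans (le_max_right _ _) (le_max_left _ _)) hs
    have hsc : Real.exp (2 * |c| / ε) ≤ s := le_trans (le_max_right _ _) hs
    have hspos : 0 < s := lt_of_lt_of_le (Real.exp_pos _) hsc
    have hlog1 : 1 ≤ Real.log s := by rw [Real.le_log_iff_exp_le hspos]; exact hse
    have hlogc : 2 * |c| / ε ≤ Real.log s := by rw [Real.le_log_iff_exp_le hspos]; exact hsc
    have hlogpos : 0 < Real.log s := by linarith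
    have hA : |c * Real.cos (ω * s) / Real.log s| ≤ ε / 2 := by
      rw [abs_div, abs_mul, abs_of_pos hlogpos, div_le_iff₀ hlogpos]
      have hcos := Real.abs_cos_le_one (ω * s)
      have h' : |c| * |Real.cos (ω * s)| ≤ |c| := by nlinarith [abs_nonneg (Real.cos (ω * s))]
      have h'' : 2 * |c| ≤ Real.log s * ε := by rwa [div_le_iff₀ hε] at hlogc
      nlinarith
    have hB : |e s| ≤ ε / 2 := by
      have h1 := hT₁ s hs1
      rw [abs_mul, abs_of_pos hlogpos] at h1
      have : |e s| ≤ |e s| * Real.log s := by nlinarith [abs_nonneg (e s)]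
      linarith
    rw [hg s]
    exact (abs_add_le _ _).trans (by linarith)
  -- Step 2: hence `g ≡ 0`.
  have hz : ∀ t, g t = 0 := eq_zero_of_isBohrAP_of_small hap h0
  -- Step 3: evaluate at `s = 2πk/ω` beyond the `|c|/2`-threshold of `e · log`.
  obtain ⟨T₁, hT₁⟩ := he (|c| / 2) (by positivity)
  obtain ⟨k, hk⟩ := exists_nat_gt (max T₁ (Real.exp 1) * ω / (2 * Real.pi))
  have hπ : 0 < 2 * Real.pi := by positivity
  set s : ℝ := 2 * Real.pi * k / ω with hs_def
  have hks : max T₁ (Real.exp 1) < s := by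
    rw [hs_def, lt_div_iff₀ hω]
    have := (div_lt_iff₀ hπ).1 hk
    linarith
  have hs1 : T₁ ≤ s := (le_max_left _ _).trans hks.le
  have hse : Real.exp 1 < s := lt_of_le_of_lt (le_max_right _ _) hks
  have hspos : 0 < s := (Real.exp_pos 1).trans hse
  have hlogpos : 0 < Real.log s := by
    have : 1 ≤ Real.log s := by rw [Real.le_log_iff_exp_le hspos]; exact hse.le
    linarith
  have hcos : Real.cos (ω * s) = 1 := by
    have : ω * s = (k : ℝ) * (2 * Real.pi) := by rw [hs_def]; field_simp
    rw [this]; exact Real.cos_nat_mul_two_pi k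
  have h1 := hz s
  rw [hg s, hcos, mul_one] at h1
  have h3 : e s * Real.log s = -c := by
    have hl : Real.log s ≠ 0 := hlogpos.ne'
    field_simp at h1
    linarith
  have h2 := hT₁ s hs1
  rw [h3, abs_neg] at h2
  linarith

end Summit.RiemannHypothesis.RiemannHypothesis.Theorems.PfPersistence.Fake1.APTest
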